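import Summits.AnomalousDissipation.AnomalousDissipation.Theses.MarginalStabilityChain
import Summits.AnomalousDissipation.AnomalousDissipation.Theorems.TwohalfdNeg.Negative.LaminarShear
import Literature.Analysis.FunctionSpaces.TorusClassicalNSGluing
import Literature.Analysis.FluidPDE.DoeringFoias
import HarnessLib

/-!
# Negative knowledge for the crux `MarginalStabilityChain.ChainRealisation` (stmt-AnomalousDissipation-14249):
# the residual of line `SketchIdeator2` minus its energy ceiling is the LAMINAR AXIAL BRANCH

Certified copy of §3 of the cdisprove work file `Cruxes/ChainRealisation/Disproof.lean`.  Supports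
stmt-AnomalousDissipation-14249 (line `SketchIdeator2`, card `separatrix-flux-pinning`, lead
prover-line-stmt-AnomalousDissipation-14249-c1-0).

The line reduces the crux to ONE conjecture-grade residual, `ContrastFamily`
(`Cruxes/ChainRealisation/Lines/SketchIdeator2.lean` §3; hypothesis `hCF` of the landed conditional glue
`Theorems.ChainRealisation.SeparatrixFluxPinning.chainRealisation_of_forwardPhase_of_contrastFamily`): a
`2½`-dimensional arena force `twoHalf g (μ • h)` carrying, along `ν_j → 0`, forward classical mean-zero
enstrophy-bounded trajectories with limsup-mean energy `≤ E`, non-negative mean planar work and a `j`-UNIFORM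
AXIAL-CONTRAST FLOOR `a₀ ≤ ⟨∫ (h∘π) u₂⟩`.

LOAD-BEARING ANALYSIS (kernel-checked; statements inline, no new definitions): delete the energy ceiling and the
residual is TRUE (`contrastFamily_holds_without_energyCeiling`), by the laminar axial branch — no planar force
(`g = 0`), axial pattern `h = cos 2πx₀`, `μ = 1`, `ν_j = 1/(j+1)` and the STEADY shear states
`u_j = (0, 0, (j+1) cos(2πx₀)/(4π²))` = the `Δ⁻¹`-response of the force (classical on `[0,∞) × T³`, zero pressure, mean
zero, constant enstrophy): planar work `0`, contrast `(j+1)/(8π²) ≥ 1/(8π²)`.  The same family has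
`meanEnergy = (j+1)²/(32π⁴)` (`meanEnergy_laminarBranch`), unbounded in `j` (`laminarBranch_exceeds`), so it is excluded
by EVERY ceiling `E`.  Reading for the lead: in the residual, the clause `∀ j, meanEnergy (u j) ≤ E` is the ONLY thing
separating the conjecture from the viscous response of the arena; every other clause (forward classical regularity,
enstrophy bound, mean zero, planar-work sign, contrast floor) is already met by a viscosity-balanced state whose
contrast grows like `ν⁻¹` and whose energy grows like `ν⁻²` — the residual IS the `ν`-uniform energy question for the
arena (Bruè–De Lellis 2023, Question 2.2), exactly as `Cruxes/ChainThesis/Disproof.lean` §3 found for the consequent.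
Sanity companion: deleting `ν_j → 0` instead also trivialises the residual
(`contrastFamily_holds_without_vanishingViscosity`, `ν = 1`).

No statement of the route is asserted; the two `…_holds_…` theorems inhabit WEAKENINGS of a line-internal statement.
-/

set_option linter.dupNamespace false

noncomputable section

namespace Summit.AnomalousDissipation.AnomalousDissipation.Theorems.ChainRealisation.Negative

open MeasureTheory Set Filter Topology
open scoped InnerProductSpace
open Literature.Analysis.FunctionSpaces Literature.Analysis.FunctionSpaces.Torus
open Literature.Analysis.FluidPDE Literature.Analysis.FluidPDE.Torus
open Summit.AnomalousDissipation.AnomalousDissipation.Theorems.TwohalfdNeg.Negative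

/-! ## The laminar axial branch of the arena `(0, 0, cos 2πx₀)` -/

/-- `4π²·1²·ν_j·a_j = 1` for `ν_j = 1/(j+1)`, `a_j = (j+1)/(4π²)`. [folklore] -/
theorem amp_rel (j : ℕ) :
    4 * Real.pi ^ 2 * (((0 : ℕ) : ℝ) + 1) ^ 2 * (1 / ((j : ℝ) + 1)) * (((j : ℝ) + 1) / (4 * Real.pi ^ 2)) = 1 := by
  have hj : (j : ℝ) + 1 ≠ 0 := by positivity
  have hπ : (Real.pi : ℝ) ^ 2 ≠ 0 := by positivity
  push_cast
  field_simp
  ring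

/-- **The laminar axial state is a FORWARD classical solution of the arena system.**  For the arena force
`twoHalf 0 ((1:ℝ) • cos 2πx₀) = (0,0,cos 2πx₀)` and `ν_j = 1/(j+1)`, the steady shear `(0,0,(j+1)cos(2πx₀)/(4π²))` with
zero pressure is classical on `[0,∞) × T³` (restriction of the complete laminar solution `isClassicalNSSolutionOn_shear`
of `TwohalfdNeg.Negative` by `Torus.IsClassicalNSSolutionOn.mono`). [folklore] -/
theorem isClassicalNSSolutionOn_laminarBranch (j : ℕ) :
    IsClassicalNSSolutionOn (Set.Ici 0) (1 / ((j : ℝ) + 1))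
      (fun _ => twoHalf (0 : UnitAddTorus (Fin 2) → EuclideanSpace ℝ (Fin 2)) ((1 : ℝ) • profile 0 1))
      (fun _ => shear 0 (((j : ℝ) + 1) / (4 * Real.pi ^ 2)))
      (fun _ => (fun _ : UnitAddTorus (Fin 2) => (0 : ℝ)) ∘ planarProj) := by
  have h := isClassicalNSSolutionOn_shear 0 (1 / ((j : ℝ) + 1)) (((j : ℝ) + 1) / (4 * Real.pi ^ 2))
  rw [amp_rel j] at h
  rw [one_smul]
  exact h.mono (subset_univ _) (uniqueDiffOn_Ici 0)

/-- Third component of the shear state: `(shear 0 a x)₂ = a cos(2πx₀)`. [folklore] -/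
theorem shear_apply_two (a : ℝ) (x : UnitAddTorus (Fin 3)) : shear 0 a x 2 = profile 0 a (planarProj x) := by
  show twoHalf 0 (profile 0 a) x 2 = _
  exact twoHalf_apply_two _ _ _

/-- **The axial contrast of the laminar branch**: `∫ cos(2πx₀) · a cos(2πx₀) dx = a/2`. [folklore] -/
theorem contrast_laminarBranch (a : ℝ) :
    ∫ x : UnitAddTorus (Fin 3), profile 0 1 (planarProj x) * shear 0 a x 2 = a / 2 := by
  simp_rw [shear_apply_two]
  have hb : AEStronglyMeasurable (fun y : UnitAddTorus (Fin 2) => profile 0 1 y * profile 0 a y) volume :=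
    ((continuous_profile 0 1).mul (continuous_profile 0 a)).aestronglyMeasurable
  rw [show (fun x : UnitAddTorus (Fin 3) => profile 0 1 (planarProj x) * profile 0 a (planarProj x)) =
      fun x => (fun y : UnitAddTorus (Fin 2) => profile 0 1 y * profile 0 a y) (planarProj x) from rfl,
    integral_comp_planarProj hb]
  have hpt : ∀ y : UnitAddTorus (Fin 2), profile 0 1 y * profile 0 a y = a * profile 0 1 y ^ 2 := fun y => by
    rw [show profile 0 a y = profile 0 (a * 1) y by rw [mul_one], profile_mul]
    ring
  simp_rw [hpt]
  rw [integral_const_mul, integral_profile_sq]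
  ring

/-- The axial-contrast functional of the (steady) laminar branch is the constant `a/2`. [folklore] -/
theorem contrast_laminarBranch_fun (a : ℝ) :
    (fun t : ℝ => ∫ x : UnitAddTorus (Fin 3),
        profile 0 1 (planarProj x) * (fun _ : ℝ => shear 0 a) t x 2) = fun _ => a / 2 := by
  funext t
  exact contrast_laminarBranch a

/-- The planar-work functional of the laminar branch vanishes identically (no planar force). [folklore] -/
theorem planarWork_laminarBranch_fun (a : ℝ) :
    (fun t : ℝ => ∫ x : UnitAddTorus (Fin 3),
        ⟪(0 : UnitAddTorus (Fin 2) → EuclideanSpace ℝ (Fin 2)) (planarProj x),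
          planarProjE ((fun _ : ℝ => shear 0 a) t x)⟫_ℝ) = fun _ => (0 : ℝ) := by
  funext t
  simp

/-- `liminf` long-time average of the zero functional. [folklore] -/
theorem longTimeAvgInf_zero_fun : longTimeAvgInf (fun _ : ℝ => (0 : ℝ)) = 0 := by
  rw [longTimeAvgInf, timeMean_zero_fun, liminf_const]

/-- **Mean energy of the laminar branch**: `⟨‖u_j‖²⟩ = a_j²/2 = (j+1)²/(32π⁴)`. [folklore] -/
theorem meanEnergy_laminarBranch (j : ℕ) :
    meanEnergy (fun _ : ℝ => shear 0 (((j : ℝ) + 1) / (4 * Real.pi ^ 2))) =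
      ((j : ℝ) + 1) ^ 2 / (32 * Real.pi ^ 4) := by
  rw [meanEnergy_shear]
  have hπ : (Real.pi : ℝ) ≠ 0 := Real.pi_ne_zero
  field_simp
  ring

/-- **THE LAMINAR BRANCH VIOLATES EVERY CEILING**: for every `E` some level `j` has `meanEnergy (u_j) > E`
(energies `∝ (j+1)² = ν_j⁻²`). [folklore] -/
theorem laminarBranch_exceeds (E : ℝ) :
    ∃ j : ℕ, E < meanEnergy (fun _ : ℝ => shear 0 (((j : ℝ) + 1) / (4 * Real.pi ^ 2))) := by
  obtain ⟨j, hj⟩ := exists_nat_gt (E * (32 * Real.pi ^ 4))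
  refine ⟨j, ?_⟩
  rw [meanEnergy_laminarBranch, lt_div_iff₀ (by positivity)]
  have h1 : (j : ℝ) < ((j : ℝ) + 1) ^ 2 := by nlinarith [(Nat.cast_nonneg j : (0 : ℝ) ≤ j)]
  linarith

/-! ## The energy ceiling is load-bearing; so is `ν_j → 0` -/

/-- **THE ENERGY CEILING IS THE LOAD-BEARING CLAUSE OF THE RESIDUAL.**  The statement proved is the line's residual
`ContrastFamily` (arena force written `twoHalf g (μ • h)` as in the landed stub files) with the clause
`∀ j, meanEnergy (u j) ≤ E` DELETED and everything else verbatim.  It is TRUE by the laminar axial branch: `g = 0`,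
`h = cos 2πx₀`, `μ = 1`, `a₀ = 1/(8π²)`, `ν_j = 1/(j+1)`, `u_j = (0,0,(j+1)cos(2πx₀)/(4π²))` (forward classical, constant
enstrophy, mean zero, planar work `0`, contrast `(j+1)/(8π²)`).  Hence a proof of the residual must USE the ceiling
against this branch (its energies are `(j+1)²/(32π⁴)`, `laminarBranch_exceeds`), and a disproof of the residual is a
statement about ENERGY-BOUNDED families only. [folklore] -/
theorem contrastFamily_holds_without_energyCeiling :
    ∃ (g : UnitAddTorus (Fin 2) → EuclideanSpace ℝ (Fin 2)) (h : UnitAddTorus (Fin 2) → ℝ) (μ a₀ : ℝ),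
      IsSmooth g ∧ IsDivFree g ∧ HasZeroMean g ∧ IsSmooth h ∧ HasZeroMean h ∧ 0 < μ ∧ 0 < a₀ ∧
      ∃ (ν : ℕ → ℝ) (u : ℕ → ℝ → UnitAddTorus (Fin 3) → EuclideanSpace ℝ (Fin 3))
        (p : ℕ → ℝ → UnitAddTorus (Fin 3) → ℝ),
        (∀ j, 0 < ν j) ∧ Tendsto ν atTop (nhds 0) ∧
        (∀ j, IsClassicalNSSolutionOn (Set.Ici 0) (ν j) (fun _ => twoHalf g (μ • h)) (u j) (p j)) ∧
        (∀ j, ∃ M : ℝ, ∀ t : ℝ, 0 ≤ t → gradNormSq (u j t) ≤ M) ∧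
        (∀ j t, 0 ≤ t → HasZeroMean (u j t)) ∧
        (∀ j, 0 ≤ longTimeAvgInf (fun t => ∫ x, ⟪g (planarProj x), planarProjE (u j t x)⟫_ℝ)) ∧
        (∀ j, a₀ ≤ longTimeAvgSup (fun t => ∫ x, h (planarProj x) * u j t x 2)) := by
  refine ⟨0, profile 0 1, 1, 1 / (8 * Real.pi ^ 2), isSmooth_zero₂,
    fun x => by simp [Torus.divergence, Torus.partialDeriv, Torus.lineDeriv], hasZeroMean_zero₂,
    isSmooth_profile 0 1, hasZeroMean_profile 0 1, one_pos, by positivity,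
    fun j => 1 / ((j : ℝ) + 1), fun j _ => shear 0 (((j : ℝ) + 1) / (4 * Real.pi ^ 2)),
    fun _ _ => (fun _ : UnitAddTorus (Fin 2) => (0 : ℝ)) ∘ planarProj,
    fun j => by positivity, tendsto_one_div_add_atTop_nhds_zero_nat, isClassicalNSSolutionOn_laminarBranch,
    fun j => ⟨gradNormSq (shear 0 (((j : ℝ) + 1) / (4 * Real.pi ^ 2))), fun _ _ => le_rfl⟩,
    fun j _ _ => hasZeroMean_shear 0 _, fun j => ?_, fun j => ?_⟩
  · rw [planarWork_laminarBranch_fun, longTimeAvgInf_zero_fun]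
  · rw [contrast_laminarBranch_fun, longTimeAvgSup_const_fun, div_div,
      div_le_div_iff₀ (by positivity) (by positivity)]
    nlinarith [Real.pi_pos, (Nat.cast_nonneg j : (0 : ℝ) ≤ j), pow_pos Real.pi_pos 2]

/-- **`ν_j → 0` IS LOAD-BEARING** (sanity): the residual with `Tendsto ν atTop (nhds 0)` DELETED (everything else
verbatim, energy ceiling included) is TRUE at the constant viscosity `ν = 1` by the laminar branch
`u = (0,0,cos(2πx₀)/(4π²))`, with `E = 1/(32π⁴)`, `a₀ = 1/(8π²)`. [folklore] -/
theorem contrastFamily_holds_without_vanishingViscosity :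
    ∃ (g : UnitAddTorus (Fin 2) → EuclideanSpace ℝ (Fin 2)) (h : UnitAddTorus (Fin 2) → ℝ) (μ a₀ E : ℝ),
      IsSmooth g ∧ IsDivFree g ∧ HasZeroMean g ∧ IsSmooth h ∧ HasZeroMean h ∧ 0 < μ ∧ 0 < a₀ ∧
      ∃ (ν : ℕ → ℝ) (u : ℕ → ℝ → UnitAddTorus (Fin 3) → EuclideanSpace ℝ (Fin 3))
        (p : ℕ → ℝ → UnitAddTorus (Fin 3) → ℝ),
        (∀ j, 0 < ν j) ∧
        (∀ j, IsClassicalNSSolutionOn (Set.Ici 0) (ν j) (fun _ => twoHalf g (μ • h)) (u j) (p j)) ∧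
        (∀ j, ∃ M : ℝ, ∀ t : ℝ, 0 ≤ t → gradNormSq (u j t) ≤ M) ∧
        (∀ j t, 0 ≤ t → HasZeroMean (u j t)) ∧
        (∀ j, meanEnergy (u j) ≤ E) ∧
        (∀ j, 0 ≤ longTimeAvgInf (fun t => ∫ x, ⟪g (planarProj x), planarProjE (u j t x)⟫_ℝ)) ∧
        (∀ j, a₀ ≤ longTimeAvgSup (fun t => ∫ x, h (planarProj x) * u j t x 2)) := by
  refine ⟨0, profile 0 1, 1, 1 / (8 * Real.pi ^ 2), 1 / (32 * Real.pi ^ 4), isSmooth_zero₂,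
    fun x => by simp [Torus.divergence, Torus.partialDeriv, Torus.lineDeriv], hasZeroMean_zero₂,
    isSmooth_profile 0 1, hasZeroMean_profile 0 1, one_pos, by positivity,
    fun _ => 1 / (((0 : ℕ) : ℝ) + 1), fun _ _ => shear 0 ((((0 : ℕ) : ℝ) + 1) / (4 * Real.pi ^ 2)),
    fun _ _ => (fun _ : UnitAddTorus (Fin 2) => (0 : ℝ)) ∘ planarProj,
    fun _ => by positivity, fun _ => isClassicalNSSolutionOn_laminarBranch 0,
    fun _ => ⟨gradNormSq (shear 0 ((((0 : ℕ) : ℝ) + 1) / (4 * Real.pi ^ 2))), fun _ _ => le_rfl⟩,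
    fun _ _ _ => hasZeroMean_shear 0 _, fun _ => ?_, fun _ => ?_, fun _ => ?_⟩
  · rw [meanEnergy_laminarBranch]
    push_cast
    norm_num
  · rw [planarWork_laminarBranch_fun, longTimeAvgInf_zero_fun]
  · rw [contrast_laminarBranch_fun, longTimeAvgSup_const_fun]
    push_cast
    exact le_of_eq (by ring)

end Summit.AnomalousDissipation.AnomalousDissipation.Theorems.ChainRealisation.Negative

end
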